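import Literature.Geometry.Lorentzian.KerrIngoingCoordRicci
import Literature.Geometry.Lorentzian.CoordRicciCovariance
import HarnessLib

/-!
# The Kerr metric in ingoing Kerr coordinates `(t*, r, μ, φ)`, V: the Christoffel symbols

Infrastructure (all results proved) for the curvature invariants of the Kerr metric (the Kretschmann
scalar `R_{abcd}R^{abcd} = 48 M² Re (r + i a cos θ)⁶/Σ⁶`, `KerrIngoingCoordKretschmann.lean`).
Continuing `KerrIngoingCoordMetric.lean` … `KerrIngoingCoordRicci.lean`, for the rational component
field `Kerr.Ingoing.bilin M a` on the coordinate space `E4` (`u = (t*, r, μ, φ)`) we record, in the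
pure coordinate calculus of `CoordCurvature.lean` (`MetricCoord.chrAt`, `MetricCoord.riemAt`, no
manifolds):

* `isMetricOn_bilin` — the components are metric components (`MetricCoord.IsMetricOn`: `C^∞`,
  symmetric, nondegenerate) on the regular set `{Σ ≠ 0, μ² ≠ 1}`; `ginv_basisFun` — their inverse
  coefficients in the coordinate basis are `Kerr.Ingoing.ginvMat` (Visser arXiv:0706.0622, (E:K2));
  generic linear algebra on the coordinate basis (`apply_eq_sum_ginvMat`, `trace_comp_of_matrix`);
* `chrAt_bv_ij` — **the Christoffel symbols** `Γ(∂_i, ∂_j) = Γ^k_{ij} ∂_k` (O'Neill 1983, Ch. 3,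
  Prop. 3.13) in closed form, rational in `r, μ` with denominators `Σ³`, `Σ²(1 − μ²)`, … (this file:
  `Γ(∂_0, ∂_j)`; `Γ(∂_i, ∂_j)`, `1 ≤ i ≤ j`, in `KerrIngoingCoordConnectionII.lean`; `i > j` by
  `MetricCoord.IsMetricOn.chrAt_comm`).

Each closed form is verified by the defining property `2 g(Γ(∂_i,∂_j), w) = K(∂_i,∂_j,w)`
(`MetricCoord.sharpAt_eq_of_forall`, the Koszul form `Kerr.Ingoing.koszulForm_bilin`) and
`field_simp`/`ring`. The closed forms were generated by computer algebra (exact rational arithmetic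
over `ℚ(r, μ, M, a)`) and are checked here by Lean; nothing is taken on trust. Exponents are written
`^ (n : ℕ)` in the generated expressions: fixing the exponent type up front keeps their elaboration
fast.

## References

* R. P. Kerr, Phys. Rev. Lett. 11 (1963) 237–238; R. P. Kerr, A. Schild, *A new class of vacuum
  solutions of the Einstein field equations* (1965), §3.
* B. O'Neill, *Semi-Riemannian geometry* (1983), Ch. 3, Prop. 3.13, Lemma 3.38, Prop. 3.36.
* M. Visser, *The Kerr spacetime: a brief introduction*, arXiv:0706.0622, (E:K1)–(E:K2).
* R. C. Henry, *Kretschmann scalar for a Kerr–Newman black hole*, Astrophys. J. 535 (2000) 350.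
-/

noncomputable section

set_option maxSynthPendingDepth 3

open Set Function Module
open scoped ContDiff Topology
open Literature.Geometry.Lorentzian.MetricCoord

namespace Literature.Geometry.Lorentzian

namespace Kerr

namespace Ingoing

variable (M a : ℝ) {u : E4}

/-! ### The Kerr components are metric components on the regular set -/

/-- The Kerr components are `C^∞` on the regular set (rational functions of `r, μ`). [folklore] -/
theorem contDiffOn_bilin : ContDiffOn ℝ ∞ (bilin M a) (regularSet a) := by
  have hc : ∀ i, ContDiff ℝ ∞ fun w : E4 ↦ w i := contDiff_euclidean.1 contDiff_id
  have hσ : ContDiff ℝ ∞ (sigma a) := by unfold sigma; fun_prop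
  have hP : ContDiff ℝ ∞ sinSq := by unfold sinSq; fun_prop
  have hH : ContDiffOn ℝ ∞ (scalarH M a) (regularSet a) := by
    unfold scalarH
    exact ((contDiff_const.mul (hc 1)).contDiffOn).div hσ.contDiffOn (fun u hu ↦ hu.1)
  have h13 : ContDiff ℝ ∞ (c13 a) := by unfold c13; fun_prop
  have h22 : ContDiffOn ℝ ∞ (c22 a) (regularSet a) := by
    unfold c22
    exact hσ.contDiffOn.div hP.contDiffOn (fun u hu ↦ hu.2)
  have h00 : ContDiffOn ℝ ∞ (h00 M a) (regularSet a) := by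
    unfold h00; exact contDiffOn_const.mul hH
  have h03 : ContDiffOn ℝ ∞ (h03 M a) (regularSet a) := by
    unfold h03; exact (contDiff_const.mul hP).neg.contDiffOn.mul (contDiffOn_const.mul hH)
  have h33 : ContDiffOn ℝ ∞ (c33 M a) (regularSet a) := by
    unfold c33
    exact ((((hc 1).pow 2).add contDiff_const).mul hP).contDiffOn.add
      ((contDiff_const.mul (hP.pow 2)).contDiffOn.mul (contDiffOn_const.mul hH))
  unfold bilin
  exact ((((contDiffOn_const.add (h13.contDiffOn.smul contDiffOn_const)).add
    (h22.smul contDiffOn_const)).add (h33.smul contDiffOn_const)).add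
    (h00.smul contDiffOn_const)).add (h03.smul contDiffOn_const)

/-- Expansion of a vector of `E4` on the coordinate basis. [folklore] -/
theorem eq_sum_basisVector (v : E4) : v = ∑ i, v i • E4.basisVector i := by
  conv_lhs => rw [← (EuclideanSpace.basisFun (Fin 4) ℝ).sum_repr v]
  simp

/-- `(Σ_i c_i ∂_i)^k = c_k`. [folklore] -/
theorem sum_smul_basisVector_apply (c : Fin 4 → ℝ) (k : Fin 4) :
    (∑ i, c i • E4.basisVector i) k = c k := by
  simp [Finset.sum_apply, Pi.single_apply]

/-- `g_u(v, ∂_j) = Σ_i vⁱ g_u(∂_i, ∂_j)`. [folklore] -/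
theorem bilin_apply_basisVector_right (u v : E4) (j : Fin 4) :
    bilin M a u v (E4.basisVector j) =
      ∑ i, v i * bilin M a u (E4.basisVector i) (E4.basisVector j) := by
  conv_lhs => rw [eq_sum_basisVector v]
  rw [map_sum, _root_.sum_apply]
  simp only [map_smul, _root_.smul_apply, smul_eq_mul]

/-- The Gram matrix of the components on the coordinate basis. [cite: arXiv07060622, (E:K1)] -/
theorem gram_eq (u : E4) :
    (Matrix.of fun i j ↦ bilin M a u (E4.basisVector i) (E4.basisVector j)) =
      !![-1 + h00 M a u, h00 M a u, 0, h03 M a u;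
         h00 M a u, 1 + h00 M a u, 0, c13 a u + h03 M a u;
         0, 0, c22 a u, 0;
         h03 M a u, c13 a u + h03 M a u, 0, c33 M a u] := by
  ext i j
  rw [Matrix.of_apply, bilin_basisVector]

/-- **The Kerr components are nondegenerate on the regular set** (`g · ginvMat = 1`,
`det g = −Σ²`). [cite: arXiv07060622, (E:K2)] -/
theorem isInvertible_bilin (hu : u ∈ regularSet a) : (bilin M a u).IsInvertible := by
  refine MetricCoord.isInvertible_of_nondegenerate fun v hv ↦ ?_
  set Gm : Matrix (Fin 4) (Fin 4) ℝ :=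
    Matrix.of fun i j ↦ bilin M a u (E4.basisVector i) (E4.basisVector j) with hGm
  have hG : Gm * ginvMat M a u = 1 := by
    rw [hGm, gram_eq]; exact gram_mul_ginvMat M a hu
  have hvG : Matrix.vecMul (fun i ↦ v i) Gm = 0 := by
    ext j
    rw [Matrix.vecMul, Pi.zero_apply]
    have h := hv (E4.basisVector j)
    rw [bilin_apply_basisVector_right] at h
    simpa [dotProduct, hGm] using h
  have h0 : (fun i ↦ v i) = 0 := by
    calc (fun i ↦ v i) = Matrix.vecMul (fun i ↦ v i) (Gm * ginvMat M a u) := by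
          rw [hG, Matrix.vecMul_one]
      _ = 0 := by rw [← Matrix.vecMul_vecMul, hvG, Matrix.zero_vecMul]
  ext i
  exact congrFun h0 i

/-- **The Kerr components are metric components on the regular set** `{Σ ≠ 0, μ² ≠ 1}`
(`MetricCoord.IsMetricOn`: smooth, symmetric, nondegenerate).
[cite: arXiv07060622, (E:K1)–(E:K2)] -/
theorem isMetricOn_bilin : IsMetricOn (bilin M a) (regularSet a) :=
  ⟨isOpen_regularSet a, contDiffOn_bilin M a, fun u _ v w ↦ bilin_symm M a u v w,
    fun _ hu ↦ isInvertible_bilin M a hu⟩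

/-- The coordinate basis of `E4` (`EuclideanSpace.basisFun`, as a `Module.Basis`) consists of the
vectors `∂_i`. [folklore] -/
theorem basisFun_toBasis_apply (i : Fin 4) :
    (EuclideanSpace.basisFun (Fin 4) ℝ).toBasis i = E4.basisVector i :=
  (congrFun (EuclideanSpace.basisFun (Fin 4) ℝ).coe_toBasis i).trans
    (EuclideanSpace.basisFun_apply _ _ i)

/-- The coordinates in the coordinate basis are the components. [folklore] -/
theorem basisFun_toBasis_coord (i : Fin 4) (v : E4) :
    (EuclideanSpace.basisFun (Fin 4) ℝ).toBasis.coord i v = v i := by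
  simp

/-- **The inverse metric coefficients of the Kerr components in the coordinate basis are
`ginvMat`** (Visser arXiv:0706.0622, (E:K2)). [cite: arXiv07060622, (E:K2)] -/
theorem ginv_basisFun (hu : u ∈ regularSet a) (i j : Fin 4) :
    ginv (bilin M a) (EuclideanSpace.basisFun (Fin 4) ℝ).toBasis u i j = ginvMat M a u i j := by
  set A : Matrix (Fin 4) (Fin 4) ℝ :=
    Matrix.of fun i j ↦ ginv (bilin M a) (EuclideanSpace.basisFun (Fin 4) ℝ).toBasis u i j with hA
  set Gm : Matrix (Fin 4) (Fin 4) ℝ :=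
    Matrix.of fun i j ↦ bilin M a u (E4.basisVector i) (E4.basisVector j) with hGm
  have h1 : A * Gm = 1 := by
    ext i k
    rw [Matrix.mul_apply, Matrix.one_apply, ← sum_ginv_mul_apply_basis
      (EuclideanSpace.basisFun (Fin 4) ℝ).toBasis (isInvertible_bilin M a hu) i k]
    refine Finset.sum_congr rfl fun j _ ↦ ?_
    rw [hA, hGm, Matrix.of_apply, Matrix.of_apply, basisFun_toBasis_apply, basisFun_toBasis_apply,
      bilin_symm]
  have h2 : Gm⁻¹ = A := Matrix.inv_eq_left_inv h1
  have h3 : Gm⁻¹ = ginvMat M a u := by rw [hGm]; exact gram_inv M a hu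
  have h4 := congrFun (congrFun (h2.symm.trans h3) i) j
  rwa [hA, Matrix.of_apply] at h4

/-- The components of a vector through the lowered pairings: `vⁱ = Σ_d g^{id} g(v, ∂_d)` for the
Kerr components (`MetricCoord.coord_eq_sum_ginv` with `g⁻¹ = ginvMat`). [cite: ONeill1983, Ch. 3,
p. 60] -/
theorem apply_eq_sum_ginvMat (hu : u ∈ regularSet a) (v : E4) (i : Fin 4) :
    v i = ∑ d, ginvMat M a u i d * bilin M a u v (E4.basisVector d) := by
  rw [← basisFun_toBasis_coord i v,
    coord_eq_sum_ginv (EuclideanSpace.basisFun (Fin 4) ℝ).toBasis (isInvertible_bilin M a hu)]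
  simp only [ginv_basisFun M a hu, basisFun_toBasis_apply]

/-- **The trace of a composition from the matrices on the coordinate basis**:
`tr(R ∘ R') = Σ_{ij} N_{ij} N'_{ji}` if `R ∂_j = Σ_i N_{ij} ∂_i` and `R' ∂_j = Σ_i N'_{ij} ∂_i`.
[folklore] -/
theorem trace_comp_of_matrix (R R' : E4 →L[ℝ] E4) (N N' : Matrix (Fin 4) (Fin 4) ℝ)
    (h : ∀ j, R (E4.basisVector j) = ∑ i, N i j • E4.basisVector i)
    (h' : ∀ j, R' (E4.basisVector j) = ∑ i, N' i j • E4.basisVector i) :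
    traceCLM E4 (R.comp R') = ∑ i, ∑ j, N i j * N' j i := by
  rw [traceCLM_apply, trace_eq_sum_coord (EuclideanSpace.basisFun (Fin 4) ℝ).toBasis]
  refine Finset.sum_congr rfl fun i _ ↦ ?_
  rw [ContinuousLinearMap.coe_coe, ContinuousLinearMap.comp_apply, basisFun_toBasis_apply,
    basisFun_toBasis_coord, h', map_sum, WithLp.ofLp_sum, Finset.sum_apply]
  refine Finset.sum_congr rfl fun j _ ↦ ?_
  rw [map_smul, h, WithLp.ofLp_smul, Pi.smul_apply, sum_smul_basisVector_apply, smul_eq_mul,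
    mul_comm]

/-- `MetricCoord.koszulCLM` and `OpensChart.koszulForm` agree up to the order of slots.
[folklore] -/
theorem koszulCLM_eq_koszulForm (G : E4 → E4 →L[ℝ] E4 →L[ℝ] ℝ) (y X Y Z : E4) :
    koszulCLM G y X Y Z = OpensChart.koszulForm G y Y X Z := rfl

/-- To identify `Γ(X, Y) = v` for the Kerr components it suffices to check
`g(2v, w) = K(X, Y, w)` for all `w` (`Γ = ½ ♯K`). [cite: ONeill1983, Ch. 3, Prop. 3.13] -/
theorem chrAt_eq_of_forall (hu : u ∈ regularSet a) {X Y v : E4}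
    (h : ∀ w, bilin M a u ((2 : ℝ) • v) w = koszulCLM (bilin M a) u X Y w) :
    chrAt (bilin M a) u X Y = v := by
  rw [chrAt_apply, sharpAt_eq_of_forall (isInvertible_bilin M a hu) h, smul_smul]
  norm_num

/-- `g(R(X,Y)Z, Z) = 0` (skew-adjointness of the curvature endomorphism).
[cite: ONeill1983, Ch. 3, Prop. 3.36 (2)] -/
theorem apply_riemAt_diag (hu : u ∈ regularSet a) (X Y Z : E4) :
    bilin M a u (riemAt (bilin M a) u X Y Z) Z = 0 := by
  have h := (isMetricOn_bilin M a).apply_riemAt_swap hu X Y Z Z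
  linarith

/-- `tr(X ∘ Y) = tr(Y ∘ X)` on `E4`. [folklore] -/
theorem traceCLM_comp_comm (X Y : E4 →L[ℝ] E4) :
    traceCLM E4 (X.comp Y) = traceCLM E4 (Y.comp X) := by
  rw [traceCLM_apply, traceCLM_apply]
  exact LinearMap.trace_mul_comm ℝ (X : E4 →ₗ[ℝ] E4) (Y : E4 →ₗ[ℝ] E4)

/-- The inverse Kerr form is symmetric. [cite: arXiv07060622, (E:K2)] -/
theorem ginvMat_symm (u : E4) (c c' : Fin 4) : ginvMat M a u c' c = ginvMat M a u c c' := by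
  fin_cases c <;> fin_cases c' <;> simp [ginvMat]

/-- `g(R(∂_A,∂_C)∂_j, ∂_d) = −g(R(∂_A,∂_C)∂_d, ∂_j)` for the Kerr components (skew-adjointness,
index form). [cite: ONeill1983, Ch. 3, Prop. 3.36 (2)] -/
theorem apply_riemAt_bv_swap (hu : u ∈ regularSet a) (A C j d : Fin 4) :
    bilin M a u (riemAt (bilin M a) u (E4.basisVector A) (E4.basisVector C) (E4.basisVector j))
      (E4.basisVector d) = -bilin M a u (riemAt (bilin M a) u (E4.basisVector A) (E4.basisVector C)
      (E4.basisVector d)) (E4.basisVector j) :=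
  (isMetricOn_bilin M a).apply_riemAt_swap hu _ _ _ _

/-! ### The Christoffel symbols in closed form -/

/-- **`Γ(∂_0, ∂_0)`** of the Kerr components in ingoing Kerr coordinates (closed form, a vector of
`E4`; O'Neill 1983, Ch. 3, Prop. 3.13). [cite: KerrSchild1965, §3] -/
theorem chrAt_bv_00 (hu : u ∈ regularSet a) :
    chrAt (bilin M a) u (E4.basisVector 0) (E4.basisVector 0) =
      !₂[(-(2 * u 1 * u 2 ^ (2 : ℕ) * M ^ (2 : ℕ) * a ^ (2 : ℕ)) +
          2 * u 1 ^ (3 : ℕ) * M ^ (2 : ℕ)) / sigma a u ^ (3 : ℕ),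
        (-(u 2 ^ (2 : ℕ) * M * a ^ (4 : ℕ)) +
          2 * u 1 * u 2 ^ (2 : ℕ) * M ^ (2 : ℕ) * a ^ (2 : ℕ) -
          u 1 ^ (2 : ℕ) * u 2 ^ (2 : ℕ) * M * a ^ (2 : ℕ) + u 1 ^ (2 : ℕ) * M * a ^ (2 : ℕ) -
          2 * u 1 ^ (3 : ℕ) * M ^ (2 : ℕ) + u 1 ^ (4 : ℕ) * M) / sigma a u ^ (3 : ℕ),
        (-(2 * u 1 * u 2 ^ (3 : ℕ) * M * a ^ (2 : ℕ)) +
          2 * u 1 * u 2 * M * a ^ (2 : ℕ)) / sigma a u ^ (3 : ℕ),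
        (-(u 2 ^ (2 : ℕ) * M * a ^ (3 : ℕ)) + u 1 ^ (2 : ℕ) * M * a) / sigma a u ^ (3 : ℕ)] := by
  refine chrAt_eq_of_forall M a hu fun w ↦ ?_
  have hS := hu.1
  have hP := hu.2
  rw [map_smul, _root_.smul_apply, koszulCLM_eq_koszulForm, koszulForm_bilin M a hu, bilin_apply]
  simp only [bilinR_apply, bilinM_apply, bv_apply, Fin.isValue, Fin.reduceEq, if_true, if_false,
    Matrix.cons_val_zero, Matrix.cons_val_one, Matrix.cons_val, smul_eq_mul, mul_one, one_mul,
    mul_zero, zero_mul, add_zero, zero_add, zero_sub]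
  simp only [h00, h03, c13, c22, c33, h00r, h00m, scalarH, scalarHr, scalarHm]
  field_simp
  simp only [sigma, sinSq]
  ring

/-- **`Γ(∂_0, ∂_1)`** of the Kerr components in ingoing Kerr coordinates (closed form, a vector of
`E4`; O'Neill 1983, Ch. 3, Prop. 3.13). [cite: KerrSchild1965, §3] -/
theorem chrAt_bv_01 (hu : u ∈ regularSet a) :
    chrAt (bilin M a) u (E4.basisVector 0) (E4.basisVector 1) =
      !₂[(-(u 2 ^ (4 : ℕ) * M * a ^ (4 : ℕ)) -
          2 * u 1 * u 2 ^ (2 : ℕ) * M ^ (2 : ℕ) * a ^ (2 : ℕ) + 2 * u 1 ^ (3 : ℕ) * M ^ (2 : ℕ) +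
          u 1 ^ (4 : ℕ) * M) / sigma a u ^ (3 : ℕ),
        (u 2 ^ (4 : ℕ) * M * a ^ (4 : ℕ) - u 2 ^ (2 : ℕ) * M * a ^ (4 : ℕ) +
          2 * u 1 * u 2 ^ (2 : ℕ) * M ^ (2 : ℕ) * a ^ (2 : ℕ) -
          u 1 ^ (2 : ℕ) * u 2 ^ (2 : ℕ) * M * a ^ (2 : ℕ) + u 1 ^ (2 : ℕ) * M * a ^ (2 : ℕ) -
          2 * u 1 ^ (3 : ℕ) * M ^ (2 : ℕ)) / sigma a u ^ (3 : ℕ),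
        (-(2 * u 1 * u 2 ^ (3 : ℕ) * M * a ^ (2 : ℕ)) +
          2 * u 1 * u 2 * M * a ^ (2 : ℕ)) / sigma a u ^ (3 : ℕ),
        (-(u 2 ^ (2 : ℕ) * M * a ^ (3 : ℕ)) + u 1 ^ (2 : ℕ) * M * a) / sigma a u ^ (3 : ℕ)] := by
  refine chrAt_eq_of_forall M a hu fun w ↦ ?_
  have hS := hu.1
  have hP := hu.2
  rw [map_smul, _root_.smul_apply, koszulCLM_eq_koszulForm, koszulForm_bilin M a hu, bilin_apply]
  simp only [bilinR_apply, bilinM_apply, bv_apply, Fin.isValue, Fin.reduceEq, if_true, if_false,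
    Matrix.cons_val_zero, Matrix.cons_val_one, Matrix.cons_val, smul_eq_mul, mul_one, one_mul,
    mul_zero, zero_mul, add_zero, zero_add]
  simp only [h00, h03, c13, c22, c33, h00r, h00m, h03r, scalarH, scalarHr, scalarHm]
  field_simp
  simp only [sigma, sinSq]
  ring

/-- **`Γ(∂_0, ∂_2)`** of the Kerr components in ingoing Kerr coordinates (closed form, a vector of
`E4`; O'Neill 1983, Ch. 3, Prop. 3.13). [cite: KerrSchild1965, §3] -/
theorem chrAt_bv_02 (hu : u ∈ regularSet a) :
    chrAt (bilin M a) u (E4.basisVector 0) (E4.basisVector 2) =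
      !₂[(2 * u 1 * u 2 * M * a ^ (2 : ℕ)) / sigma a u ^ (2 : ℕ),
        0,
        0,
        (2 * u 1 * u 2 * M * a) / (sigma a u ^ (2 : ℕ) * sinSq u)] := by
  refine chrAt_eq_of_forall M a hu fun w ↦ ?_
  have hS := hu.1
  have hP := hu.2
  rw [map_smul, _root_.smul_apply, koszulCLM_eq_koszulForm, koszulForm_bilin M a hu, bilin_apply]
  simp only [bilinR_apply, bilinM_apply, bv_apply, Fin.isValue, Fin.reduceEq, if_true, if_false,
    Matrix.cons_val_zero, Matrix.cons_val_one, Matrix.cons_val, smul_eq_mul, mul_one, one_mul,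
    mul_zero, zero_mul, add_zero, zero_add, sub_zero]
  simp only [h00, h03, c13, c33, h00m, h03m, scalarH, scalarHm]
  field_simp
  simp only [sigma, sinSq]
  ring

/-- **`Γ(∂_0, ∂_3)`** of the Kerr components in ingoing Kerr coordinates (closed form, a vector of
`E4`; O'Neill 1983, Ch. 3, Prop. 3.13). [cite: KerrSchild1965, §3] -/
theorem chrAt_bv_03 (hu : u ∈ regularSet a) :
    chrAt (bilin M a) u (E4.basisVector 0) (E4.basisVector 3) =
      !₂[(-(2 * u 1 * u 2 ^ (4 : ℕ) * M ^ (2 : ℕ) * a ^ (3 : ℕ)) +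
          2 * u 1 * u 2 ^ (2 : ℕ) * M ^ (2 : ℕ) * a ^ (3 : ℕ) +
          2 * u 1 ^ (3 : ℕ) * u 2 ^ (2 : ℕ) * M ^ (2 : ℕ) * a -
          2 * u 1 ^ (3 : ℕ) * M ^ (2 : ℕ) * a) / sigma a u ^ (3 : ℕ),
        (-(u 2 ^ (4 : ℕ) * M * a ^ (5 : ℕ)) +
          2 * u 1 * u 2 ^ (4 : ℕ) * M ^ (2 : ℕ) * a ^ (3 : ℕ) -
          u 1 ^ (2 : ℕ) * u 2 ^ (4 : ℕ) * M * a ^ (3 : ℕ) + u 2 ^ (2 : ℕ) * M * a ^ (5 : ℕ) -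
          2 * u 1 * u 2 ^ (2 : ℕ) * M ^ (2 : ℕ) * a ^ (3 : ℕ) +
          2 * u 1 ^ (2 : ℕ) * u 2 ^ (2 : ℕ) * M * a ^ (3 : ℕ) -
          2 * u 1 ^ (3 : ℕ) * u 2 ^ (2 : ℕ) * M ^ (2 : ℕ) * a +
          u 1 ^ (4 : ℕ) * u 2 ^ (2 : ℕ) * M * a - u 1 ^ (2 : ℕ) * M * a ^ (3 : ℕ) +
          2 * u 1 ^ (3 : ℕ) * M ^ (2 : ℕ) * a - u 1 ^ (4 : ℕ) * M * a) / sigma a u ^ (3 : ℕ),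
        (2 * u 1 * u 2 ^ (3 : ℕ) * M * a ^ (3 : ℕ) + 2 * u 1 ^ (3 : ℕ) * u 2 ^ (3 : ℕ) * M * a -
          2 * u 1 * u 2 * M * a ^ (3 : ℕ) -
          2 * u 1 ^ (3 : ℕ) * u 2 * M * a) / sigma a u ^ (3 : ℕ),
        (-(u 2 ^ (4 : ℕ) * M * a ^ (4 : ℕ)) + u 2 ^ (2 : ℕ) * M * a ^ (4 : ℕ) +
          u 1 ^ (2 : ℕ) * u 2 ^ (2 : ℕ) * M * a ^ (2 : ℕ) -
          u 1 ^ (2 : ℕ) * M * a ^ (2 : ℕ)) / sigma a u ^ (3 : ℕ)] := by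
  refine chrAt_eq_of_forall M a hu fun w ↦ ?_
  have hS := hu.1
  have hP := hu.2
  rw [map_smul, _root_.smul_apply, koszulCLM_eq_koszulForm, koszulForm_bilin M a hu, bilin_apply]
  simp only [bilinR_apply, bilinM_apply, bv_apply, Fin.isValue, Fin.reduceEq, if_true, if_false,
    Matrix.cons_val_zero, Matrix.cons_val_one, Matrix.cons_val, smul_eq_mul, mul_one, one_mul,
    mul_zero, zero_mul, add_zero, zero_add, zero_sub]
  simp only [h00, h03, c13, c22, c33, h00r, h00m, h03r, h03m, scalarH, scalarHr, scalarHm]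
  field_simp
  simp only [sigma, sinSq]
  ring

end Ingoing

end Kerr

end Literature.Geometry.Lorentzian

end
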